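import Summits.QuantumFields.YangMills.Theorems.BalabanLadderIRDefectSquaringSharpExtension
import Summits.QuantumFields.YangMills.Theorems.BalabanLadderIRAbstractBasinRung24
import HarnessLib

/-!
# The aspect window of the IR seed (line `near-cube-witness`, ym-ir-idea-13 g2, lens «control» — aspect ≤ 2:1 / 17754
territory; helper on crux `BalabanLadder.IR`, stmt-QuantumFields-19354; sorry-free, group-blind, count-neutral)

THE ASPECT WINDOW OF THE SEED.  The bill of record re-bases its seed on `BasinRung.ColdExitAt (1/24)` (one `1/24`-pure cold
`4:1` torus `L³ × {⌊L/4⌋, 2⌊L/4⌋}`, `L ≥ 8`, per `β`; `BasinRung.IR_of_exitAt24`).  This file proves, sorry-free and group-blind,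
that the seed may be witnessed at ANY aspect `a = t/L ∈ [1/4, p/q]`, `p < q`, with the explicit tolerance
`θ_{p,q} = (q − p)³ / (8192 p³)`:

* §A (abstract class `[Sym]+[TM]`): `boxDefect Z (4t) ≤ 2 (B_{p,q} δ) e^{B_{p,q} δ}` for `δ = δ^{(t)}(L)`, `q t ≤ p L`, `L ≤ 4t`,
  `B_{p,q} = 2 (4p/(q−p))³` (`aspectDefect_extension` of the landed `SharpExtension` file at `L' = 4t`); and conversely
  `δ^{(t)}(L) ≤ 4 δ^{(⌊L/4⌋)}(L)` for `t ≥ ⌊L/4⌋` (colder is purer, `exc_antitone`).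
* §B (model): `AspectExitAt p q θ` — ONE box pair `L³ × {t, 2t}` with `q t ≤ p L ≤ 4 p t`... (precisely `q t ≤ p L`, `L ≤ 4 t`,
  `t ≥ 2`) and `δ^{(t)}_β(L) ≤ θ`, eventually in `β`; `coldExitAt_of_aspectExitAt : AspectExitAt p q θ → ColdExitAt (2 B θ e^{Bθ})`
  and `aspectExitAt_of_coldExitAt : ColdExitAt θ → AspectExitAt p q (8 θ²)` (`q ≤ 2p`).
* §C: `IR_of_aspectExit : p < q → AspectExitAt p q θ_{p,q} → AFToColdPressure → IRnsc → IR` (`B θ_{p,q} = 1/64`,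
  `2/64 · e^{1/64} ≤ 1/24`, then `IR_of_exitAt_le24`); instances `2:1` (`θ = 2⁻¹³`), `3:4`, `7:8` (`θ = 1/(8192·343)`).

WHY (finite-box-purity programme, director №16/№18): the conversion constant is polynomial in `1/(1 − a)` while the purity of a
confining theory's box improves exponentially in the time extent, so the CHEAPEST finite witness is not the `4:1` box but a
NEAR-CUBE a few lattice steps below the self-dual point `a = 1` (where the extension lemma stops: `t < L` is required —
B-selfdual).  GUIDANCE (dilute-gas synthesis of FINITE-BOX-PURITY.md §4, SU(2), β_W = 2.4): `22³ × {17, 34}` (a = 0.77,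
δ ≈ 1.2·10⁻⁶ vs θ_req 4.1·10⁻⁶; 1.45·10⁶ links, side 2.6 fm, T ≈ 98 MeV) converts to the `1/24` ladder, versus `40³ × {10, 20}`
(5.1·10⁶ links, 4.8 fm) / `44³ × {11, 22}` (7.5·10⁶, 5.2 fm).  Count-neutral: the wall (one pure box per β, uniformly) is untouched.
HONESTY: nothing here proves the Yang–Mills mass gap; R4 closes only the conditional finite-𝕋⁴ rung `BalabanLadder.UV`; IR 0/1.
-/

noncomputable section

open MeasureTheory Filter
open scoped BigOperators Topology
open Literature.MathematicalPhysics.QuantumFieldTheory Literature.MathematicalPhysics.QuantumLattice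
open Summit.QuantumFields.YangMills.Cruxes.IR.AspectBootstrap
open Summit.QuantumFields.YangMills.Cruxes.IR.ColdPurityBridge (coldDefect ColdExitSC)
open Summit.QuantumFields.YangMills.Cruxes.IR.ColdPressurePincer (AFToColdPressure IRnsc)
open Summit.QuantumFields.YangMills.Cruxes.IR.BasinRung (ColdExitAt IR_of_exitAt_le24 coldExitAt_mono)

namespace Summit.QuantumFields.YangMills.Cruxes.IR.NearCubeWitness

/-! ## §A The aspect window in the abstract class (sorry-free) -/

/-- The conversion constant of the aspect class `t/L ≤ p/q`: `B_{p,q} = 2 (4p/(q−p))³`. -/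
def Bpq (p q : ℕ) : ℝ := 2 * (4 * (p : ℝ) / ((q : ℝ) - p)) ^ 3

/-- The tolerance of the aspect class: `θ_{p,q} = (q−p)³/(8192 p³)` (so that `B_{p,q} θ_{p,q} = 1/64`). -/
def thetaPQ (p q : ℕ) : ℝ := (((q : ℝ) - p) ^ 3) / (8192 * (p : ℝ) ^ 3)

/-- `0 ≤ B_{p,q}` for `p < q`. -/
theorem Bpq_nonneg {p q : ℕ} (hpq : p < q) : 0 ≤ Bpq p q := by
  unfold Bpq
  have : (0 : ℝ) < (q : ℝ) - p := by
    have : (p : ℝ) < q := by exact_mod_cast hpq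
    linarith
  positivity

/-- `B_{p,q} θ_{p,q} = 1/64` (`0 < p < q`). -/
theorem Bpq_mul_thetaPQ {p q : ℕ} (hp : 0 < p) (hpq : p < q) : Bpq p q * thetaPQ p q = 1 / 64 := by
  unfold Bpq thetaPQ
  have hq : (0 : ℝ) < (q : ℝ) - p := by
    have : (p : ℝ) < q := by exact_mod_cast hpq
    linarith
  have hp' : (0 : ℝ) < p := by exact_mod_cast hp
  field_simp
  ring

/-- `u ↦ 2 u e^u` is monotone on `0 ≤ u`. -/
theorem two_mul_exp_mono {u v : ℝ} (hu : 0 ≤ u) (huv : u ≤ v) :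
    2 * u * Real.exp u ≤ 2 * v * Real.exp v := by
  have h1 : Real.exp u ≤ Real.exp v := Real.exp_le_exp.2 huv
  have h2 : 0 ≤ Real.exp u := (Real.exp_pos u).le
  have h3 : 0 ≤ v := le_trans hu huv
  nlinarith [Real.exp_pos v]

/-- In the aspect class `q t ≤ p L`, `p < q`, `t ≥ 2`: the time is shorter than the side. -/
theorem lt_of_aspect {p q L t : ℕ} (hpq : p < q) (ht : 2 ≤ t) (hqt : q * t ≤ p * L) : t < L := by
  by_contra h
  push Not at h
  have h1 : p * L ≤ p * t := Nat.mul_le_mul_left p h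
  nlinarith

/-- In the aspect class `q t ≤ p L`, `p < q`, `t ≥ 2`: `p > 0`. -/
theorem pos_of_aspect {p q L t : ℕ} (hpq : p < q) (ht : 2 ≤ t) (hqt : q * t ≤ p * L) : 0 < p := by
  rcases Nat.eq_zero_or_pos p with h | h
  · subst h
    simp at hqt
    omega
  · exact h

section Family

variable {Z : ℕ → ℕ → ℕ → ℕ → ℝ}

/-- **Aspect `≤ p/q` purity ⇒ `4:1` purity at side `4t`** (class `[Sym]+[TM]`): for `2 ≤ t`, `q t ≤ p L`, `L ≤ 4 t`, `p < q`:
`δ^{(⌊4t/4⌋)}(4t) ≤ 2 (B_{p,q} δ) e^{B_{p,q} δ}`, `δ = δ^{(t)}(L)` — `aspectDefect_extension` at `L' = 4t` with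
`4t/(L − t) ≤ 4p/(q − p)`. -/
theorem boxDefect_le_of_aspectDefect (hS : IsAxisSymmetric Z) (hT : IsTracePositive Z) {p q L t : ℕ}
    (hpq : p < q) (ht : 2 ≤ t) (hqt : q * t ≤ p * L) (hL4 : L ≤ 4 * t) :
    boxDefect Z (4 * t) ≤ 2 * (Bpq p q * aspectDefect Z L t) * Real.exp (Bpq p q * aspectDefect Z L t) := by
  have htL : t < L := lt_of_aspect hpq ht hqt
  have hp : 0 < p := pos_of_aspect hpq ht hqt
  have key := aspectDefect_extension hS hT ht htL hL4
  have h44 : 4 * t / 4 = t := by omega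
  rw [boxDefect_eq_aspectDefect, h44]
  set δ := aspectDefect Z L t with hδ
  have hδ0 : 0 ≤ δ := (aspectDefect_facts hT (L := L) (t := t) (by omega) ht).1
  -- the actual constant is at most the class constant
  have htr : ((t : ℕ) : ℝ) < (L : ℝ) := by exact_mod_cast htL
  have hden : 0 < (L : ℝ) - (t : ℝ) := by linarith
  have hqp : (0 : ℝ) < (q : ℝ) - p := by
    have : (p : ℝ) < q := by exact_mod_cast hpq
    linarith
  have hqt' : (q : ℝ) * t ≤ (p : ℝ) * L := by exact_mod_cast hqt
  have hratio : (((4 * t : ℕ)) : ℝ) / ((L : ℝ) - t) ≤ 4 * (p : ℝ) / ((q : ℝ) - p) := by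
    rw [div_le_div_iff₀ hden hqp]
    push_cast
    nlinarith
  have hr0 : 0 ≤ (((4 * t : ℕ)) : ℝ) / ((L : ℝ) - t) := div_nonneg (by positivity) hden.le
  have hB : 2 * ((((4 * t : ℕ)) : ℝ) / ((L : ℝ) - t)) ^ 3 ≤ Bpq p q := by
    unfold Bpq
    have := pow_le_pow_left₀ hr0 hratio 3
    linarith
  have hB0 : 0 ≤ 2 * ((((4 * t : ℕ)) : ℝ) / ((L : ℝ) - t)) ^ 3 := by positivity
  calc aspectDefect Z (4 * t) t
        ≤ 2 * ((2 * ((((4 * t : ℕ)) : ℝ) / ((L : ℝ) - t)) ^ 3) * δ) *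
          Real.exp ((2 * ((((4 * t : ℕ)) : ℝ) / ((L : ℝ) - t)) ^ 3) * δ) := key
    _ ≤ 2 * (Bpq p q * δ) * Real.exp (Bpq p q * δ) :=
          two_mul_exp_mono (mul_nonneg hB0 hδ0) (mul_le_mul_of_nonneg_right hB hδ0)

/-- **Colder is purer** (class `[TM]`): for `⌊L/4⌋ ≤ t`, `8 ≤ L`, if `δ^{(⌊L/4⌋)}(L) ≤ 1/2` then `δ^{(t)}(L) ≤ 4 δ^{(⌊L/4⌋)}(L)`
(`δ^{(t)} ≤ 2 x_t ≤ 2 x_{⌊L/4⌋} ≤ 4 δ^{(⌊L/4⌋)}`, `exc_antitone`, `defect_facts`). -/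
theorem aspectDefect_le_of_boxDefect (hT : IsTracePositive Z) {L t : ℕ} (hL : 8 ≤ L) (ht : L / 4 ≤ t)
    (hδ : boxDefect Z L ≤ 1 / 2) : aspectDefect Z L t ≤ 4 * boxDefect Z L := by
  have hL2 : 2 ≤ L := by omega
  have ht4 : 2 ≤ L / 4 := by omega
  have ht2 : 2 ≤ t := le_trans ht4 ht
  have hz : HasSpectralDatum (Z L L L) := hT L L L hL2 hL2 hL2
  obtain ⟨-, -, h2, -⟩ := aspectDefect_facts hT (L := L) (t := t) hL2 ht2
  obtain ⟨-, -, -, h3⟩ := aspectDefect_facts hT (L := L) (t := L / 4) hL2 ht4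
  rw [boxDefect_eq_aspectDefect] at hδ ⊢
  have hx : exc (Z L L L) (L / 4) ≤ 2 * aspectDefect Z L (L / 4) := h3 hδ
  obtain ⟨k, hk⟩ : ∃ k, t = k + 2 := ⟨t - 2, by omega⟩
  obtain ⟨m, hm⟩ : ∃ m, L / 4 = m + 2 := ⟨L / 4 - 2, by omega⟩
  have hanti : exc (Z L L L) t ≤ exc (Z L L L) (L / 4) := by
    rw [hk, hm]; exact exc_antitone hz (by omega)
  linarith

end Family

/-! ## §B The model: the seed at aspect `≤ p/q` (sorry-free seams) -/

section Model

variable {G : Type} [Group G] [TopologicalSpace G] [IsTopologicalGroup G] [CompactSpace G]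
  [MeasurableSpace G] [BorelSpace G]

/-- Model instance of §A: `δᶜ_β(4t) ≤ 2 (B_{p,q} δ) e^{B_{p,q} δ}`, `δ = δ^{(t)}_β(L)`, for `β ≥ 0`, `2 ≤ t`, `q t ≤ p L`,
`L ≤ 4t`, `p < q`. -/
theorem coldDefect_le_of_aspectDefect (r : LatticeRep G) {β : ℝ} (hβ : 0 ≤ β) {p q L t : ℕ}
    (hpq : p < q) (ht : 2 ≤ t) (hqt : q * t ≤ p * L) (hL4 : L ≤ 4 * t) :
    coldDefect r.ρ β (4 * t) ≤
      2 * (Bpq p q * aspectDefect (wilsonFinTorusPartition r.ρ β) L t) *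
        Real.exp (Bpq p q * aspectDefect (wilsonFinTorusPartition r.ρ β) L t) := by
  rw [coldDefect_eq_boxDefect]
  exact boxDefect_le_of_aspectDefect (axisSymmetric r β) (tracePositive r hβ) hpq ht hqt hL4

end Model

/-- **`A_{p,q}(θ)` = `AspectExitAt p q θ` — the seed at aspect `≤ p/q`, ONE tolerance, ONE box pair per `β`.**  For every
simply-connected compact simple `G` and lattice representation `r`, eventually in `β`: some pair of tori `L³ × t`, `L³ × 2t`
with `2 ≤ t`, `q t ≤ p L`, `L ≤ 4 t` has period-doubling defect `δ^{(t)}_β(L) = 1 − Z_β(L³×2t)/Z_β(L³×t)² ≤ θ`.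
`A_{1,4}` at `t = ⌊L/4⌋`-compatible data is `ColdExitAt`; `A_{1,2}` is the `2:1` seed of line `sharp-extension` at one tolerance. -/
def AspectExitAt (p q : ℕ) (θ : ℝ) : Prop :=
  ∀ (G : Type) [Group G] [TopologicalSpace G] [IsTopologicalGroup G] [CompactSpace G],
    IsCompactSimpleLieGroup G → SimplyConnectedSpace G →
    letI : MeasurableSpace G := borel G; haveI : BorelSpace G := ⟨rfl⟩;
    ∀ r : LatticeRep G, ∃ β₁ : ℝ, ∀ β : ℝ, β₁ ≤ β →
      ∃ L t : ℕ, 2 ≤ t ∧ q * t ≤ p * L ∧ L ≤ 4 * t ∧ aspectDefect (wilsonFinTorusPartition r.ρ β) L t ≤ θ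

/-- **`A_{p,q}(θ) ⇒ E(2 B θ e^{Bθ})`**, `B = B_{p,q}`, `p < q` (any `θ`; for `θ < 0` the hypothesis is void). -/
theorem coldExitAt_of_aspectExitAt {p q : ℕ} (hpq : p < q) {θ : ℝ} (hE : AspectExitAt p q θ) :
    ColdExitAt (2 * (Bpq p q * θ) * Real.exp (Bpq p q * θ)) := by
  intro G _ _ _ _ hG hsc
  letI : MeasurableSpace G := borel G
  haveI : BorelSpace G := ⟨rfl⟩
  intro r
  obtain ⟨β₁, hβ₁⟩ := hE G hG hsc r
  refine ⟨max β₁ 0, fun β hβ => ?_⟩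
  have hββ₁ : β₁ ≤ β := le_trans (le_max_left _ _) hβ
  have hβ0 : 0 ≤ β := le_trans (le_max_right _ _) hβ
  obtain ⟨L, t, ht, hqt, hL4, hδ⟩ := hβ₁ β hββ₁
  refine ⟨4 * t, by omega, ?_⟩
  have hB0 := Bpq_nonneg hpq
  have htL : t < L := lt_of_aspect hpq ht hqt
  have hδ0 : 0 ≤ aspectDefect (wilsonFinTorusPartition r.ρ β) L t :=
    (aspectDefect_facts (tracePositive r hβ0) (L := L) (t := t) (by omega) ht).1
  calc coldDefect r.ρ β (4 * t)
        ≤ 2 * (Bpq p q * aspectDefect (wilsonFinTorusPartition r.ρ β) L t) *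
          Real.exp (Bpq p q * aspectDefect (wilsonFinTorusPartition r.ρ β) L t) :=
        coldDefect_le_of_aspectDefect r hβ0 hpq ht hqt hL4
    _ ≤ 2 * (Bpq p q * θ) * Real.exp (Bpq p q * θ) :=
        two_mul_exp_mono (mul_nonneg hB0 hδ0) (mul_le_mul_of_nonneg_left hδ hB0)

/-- **`E(θ) ⇒ A_{p,q}(8 θ²)`** for every class containing aspect `1/2` (`q ≤ 2p`), `0 ≤ θ`: witness `t = ⌊L/2⌋` and the landed
`aspectDefect_of_two_mul_le` (lengthening the time squares the defect). -/
theorem aspectExitAt_of_coldExitAt {p q : ℕ} (hqp : q ≤ 2 * p) {θ : ℝ} (hE : ColdExitAt θ) :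
    AspectExitAt p q (8 * θ ^ 2) := by
  intro G _ _ _ _ hG hsc
  letI : MeasurableSpace G := borel G
  haveI : BorelSpace G := ⟨rfl⟩
  intro r
  obtain ⟨β₁, hβ₁⟩ := hE G hG hsc r
  refine ⟨max β₁ 0, fun β hβ => ?_⟩
  have hββ₁ : β₁ ≤ β := le_trans (le_max_left _ _) hβ
  have hβ0 : 0 ≤ β := le_trans (le_max_right _ _) hβ
  obtain ⟨L, hL, hδ⟩ := hβ₁ β hββ₁
  refine ⟨L, L / 2, by omega, ?_, by omega, ?_⟩
  · have h1 : q * (L / 2) ≤ 2 * p * (L / 2) := Nat.mul_le_mul_right _ hqp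
    have h2 : 2 * p * (L / 2) = p * (2 * (L / 2)) := by ring
    have h3 : p * (2 * (L / 2)) ≤ p * L := Nat.mul_le_mul_left p (Nat.mul_div_le L 2)
    omega
  · have hsq := aspectDefect_of_two_mul_le (tracePositive r hβ0) (Z := wilsonFinTorusPartition r.ρ β)
      (L := L) (t := L / 4) (t' := L / 2) (by omega) (by omega) (by omega)
    rw [← coldDefect_eq_aspectDefect] at hsq
    have hδ0 : 0 ≤ coldDefect r.ρ β L := by
      have := (aspectDefect_facts (tracePositive r hβ0) (Z := wilsonFinTorusPartition r.ρ β)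
        (L := L) (t := L / 4) (by omega) (by omega)).1
      rwa [← coldDefect_eq_aspectDefect] at this
    calc aspectDefect (wilsonFinTorusPartition r.ρ β) L (L / 2) ≤ 8 * coldDefect r.ρ β L ^ 2 := hsq
      _ ≤ 8 * θ ^ 2 := by gcongr

/-! ## §C The bill with the seed at aspect `≤ p/q` (sorry-free) -/

/-- `2/64 · e^{1/64} ≤ 1/24`. -/
theorem two_mul_exp_at_64 : 2 * (1 / 64 : ℝ) * Real.exp (1 / 64) ≤ 1 / 24 := by
  have h := Real.abs_exp_sub_one_sub_id_le (x := (1 / 64 : ℝ)) (by norm_num)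
  have h' : Real.exp (1 / 64 : ℝ) ≤ 1 + 1 / 64 + (1 / 64) ^ 2 := by
    have := (abs_le.1 h).2
    linarith
  nlinarith [Real.exp_pos (1 / 64 : ℝ)]

/-- **`IR` from the seed at aspect `≤ p/q` at tolerance `θ_{p,q} = (q−p)³/(8192 p³)`**, the AF pin `X` and the residual `N`:
`A_{p,q}(θ_{p,q}) ⇒ E(2/64 · e^{1/64}) ⇒ E(1/24)`-ladder (`IR_of_exitAt_le24`). -/
theorem IR_of_aspectExit {p q : ℕ} (hp : 0 < p) (hpq : p < q) (hE : AspectExitAt p q (thetaPQ p q))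
    (hX : AFToColdPressure) (hN : IRnsc) :
    Summit.QuantumFields.YangMills.Theses.BalabanLadder.IR := by
  have hE' := coldExitAt_of_aspectExitAt hpq hE
  rw [Bpq_mul_thetaPQ hp hpq] at hE'
  exact IR_of_exitAt_le24 two_mul_exp_at_64 hE' hX hN

/-- `θ_{1,2} = 2⁻¹³`: the `2:1` seed at ONE tolerance (`L³ × {t, 2t}`, `2t ≤ L ≤ 4t`). -/
theorem thetaPQ_one_two : thetaPQ 1 2 = 1 / 2 ^ 13 := by unfold thetaPQ; norm_num

/-- `θ_{3,4} = 1/221184`. -/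
theorem thetaPQ_three_four : thetaPQ 3 4 = 1 / 221184 := by unfold thetaPQ; norm_num

/-- `θ_{7,8} = 1/2809856` (`= 1/(8192·343) ≈ 3.6·10⁻⁷`): the near-cube class `t/L ≤ 7/8`. -/
theorem thetaPQ_seven_eight : thetaPQ 7 8 = 1 / 2809856 := by unfold thetaPQ; norm_num

/-- **`2:1` instance**: `A_{1,2}(2⁻¹³) → X → N → IR`. -/
theorem IR_of_twoOneExitAt (hE : AspectExitAt 1 2 (1 / 2 ^ 13)) (hX : AFToColdPressure) (hN : IRnsc) :
    Summit.QuantumFields.YangMills.Theses.BalabanLadder.IR :=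
  IR_of_aspectExit (p := 1) (q := 2) (by norm_num) (by norm_num) (by rwa [thetaPQ_one_two]) hX hN

/-- **Near-cube instance**: `A_{7,8}(1/2809856) → X → N → IR`. -/
theorem IR_of_nearCubeExitAt (hE : AspectExitAt 7 8 (1 / 2809856)) (hX : AFToColdPressure) (hN : IRnsc) :
    Summit.QuantumFields.YangMills.Theses.BalabanLadder.IR :=
  IR_of_aspectExit (p := 7) (q := 8) (by norm_num) (by norm_num) (by rwa [thetaPQ_seven_eight]) hX hN

/-- Link to line `sharp-extension`: a `2:1` datum `δ₂,β(L) ≤ θ` at `L ≥ 4` is an `A_{1,2}` datum (`t = ⌊L/2⌋`). -/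
theorem aspect_datum_of_twoOneDefect {G : Type} [Group G] [TopologicalSpace G] [IsTopologicalGroup G] [CompactSpace G]
    [MeasurableSpace G] [BorelSpace G] {N : ℕ} (ρ : G →* Matrix (Fin N) (Fin N) ℂ) (β θ : ℝ) {L : ℕ} (hL : 4 ≤ L)
    (h : twoOneDefect ρ β L ≤ θ) :
    ∃ L' t : ℕ, 2 ≤ t ∧ 2 * t ≤ 1 * L' ∧ L' ≤ 4 * t ∧ aspectDefect (wilsonFinTorusPartition ρ β) L' t ≤ θ :=
  ⟨L, L / 2, by omega, by omega, by omega, by rwa [twoOneDefect_eq] at h⟩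

end Summit.QuantumFields.YangMills.Cruxes.IR.NearCubeWitness

end
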